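import Mathlib
import Summits.Ventures.PercRepro2.HCov
import Summits.Ventures.PercRepro2.BHKAvoid
import Summits.Ventures.PercRepro2.BHKEvents
import Summits.Ventures.PercRepro2.ExploreA3
import Summits.Ventures.PercRepro2.RootLeafUSigns
import Summits.Ventures.PercRepro2.RootLeafUHalf
import Summits.Ventures.PercRepro2.RootLeafUOu
import Summits.Ventures.PercRepro2.RootLeafUTowerBHK
import Summits.Ventures.PercRepro2.RootLeafUClaimI
import Summits.Ventures.PercRepro2.RootLeafUKMaster
import Summits.Ventures.PercRepro2.RootLeafUMixHb
import Summits.Ventures.PercRepro2.RootLeafUMixHbThm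

/-!
# The `o ∈ K` half of the second root-leaf coefficient, cleared by `W′ = P(a₂ ↮ {u, c})`: the exact
identity `W′·T2oK = A·δK + 2β·(b) + 2β·(c) + ℰ·q6` and the reduction `0 ≤ T2oK ⟸ 0 ≤ K3 := A·δK + 2β·(b)`
for EVERY instance (blind cell PercRepro2, p4 g25; S3 (G4-u), proofs/P4-G25-KSIDE.md)

With `T′ = Q ∩ {u ↔ c}`, `t′ = P(T′)`, `R′ = PD ⊔ T′ = {a₂ ↮ u, a₂ ↮ c}`, `W′ = P(R′) = D + t′`, `oK = {a₂ ↔ o}`,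
`e0 = P(a₂ ↮ c, a₂ ↔ o)`, `A = κ + α` (the coefficient of `P(PD, oL)` in `T2oL`), `β = D + d0·Z`, and `T2oK` (RootLeafUHalf):

* **`W_mul_T2oK_eq`**: `W′·T2oK = A·δK + 2β·(b) + 2β·(c) + ℰ·q6` — a `ring` identity after the splits `Q = PD ⊔ T ⊔ T′`
  and `gap = P(Q,bK) − P(Q,bL)` (it absorbs `OK_eq_zero`), with
  `δK = t′·P(PD,oK) − D·P(T′,oK)` (BHK06 1.4 on `R′`, `deltaK_nonneg`),
  `(b) = W′·P(T′,oK,bK) − P(R′,oK)·P(T′,bK)` (of BOTH signs),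
  `(c) = P(R′,oK)·P(R′,bL) − W′·P(R′,oK,bL)` (BHK06 1.4 on `R′`, `c_nonneg`),
  `q6 = e0·W′ − d0·P(R′,oK)` (BHK06 1.3 on `{a₂ ↮ c}`, `q6_nonneg`: `1_{o ∈ K}` and `1_{u ∈ K}` are positively
  correlated given `K ∌ c`), and `0 ≤ ℰ` (`Ee_nonneg`);
* hence **`T2oK_nonneg_of_K3`**: `0 ≤ A·δK + 2β·(b) → 0 ≤ T2oK` (`W′ = 0` forces every `R′`-mass to vanish and
  `T2oK = ℰ·e0 ≥ 0`) — the `o ∈ K` half of W1 is reduced to the single whole-instance claim `0 ≤ K3 := A·δK + 2β·(b)`,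
  i.e. `Cov(1_{o∈K}, P(c ∈ L | K)·(1_{b∈K} − A/(2β))) ≥ 0` under `P(· | a₂ ↮ {u, c})`, census-true on every
  instance tested (1,200 random general instances; the 2,208 near-degenerate cells of the engine's D368 harvest
  exactly; tight when `b` is a pendant at `a₂`, where `A = 2β·hb` and `(b) = −hb·δK`);
* **`F1_nonneg`**: `0 ≤ hb·δK + (b)` with `hb = P(a₂ ↔ b)` — the `ρ = hb` bound of p4 g14 WITHOUT its `b ∈ L` slack
  (`Cov(1_{o∈K}, P(c ∈ L | K)·(1_{b∈K} − hb)) ≥ 0` under `P(· | a₂ ↮ {u, c})`): the same proof — the exploration of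
  `L = C(u)` (`J0_eq`, `J_le`), BHK06 Thm 1.4 in functional form for the antitone `φ(L) = hb·1_{c∉L} + g(L)·1_{c∈L}`
  (`bhk_cross_functional_avoid`) — so `0 ≤ K3` holds whenever `A ≥ 2β·hb`; the open case is `A < 2β·hb`.
-/

namespace Summit.Ventures.PercRepro2

open UnionCluster CovForm

namespace RootLeafU

namespace KSide

variable {V : Type*} {E : Type*} [Fintype E] [DecidableEq E] [Fintype V] [DecidableEq V]
  {R : Type*} [Field R] [LinearOrder R] [IsStrictOrderedRing R]

variable (p : E → R) (ends : E → Sym2 V) (o a₂ c b u : V)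

omit [Fintype V] in
/-- **The `W′`-identity of the `o ∈ K` half**: `W′·T2oK = A·δK + 2β·(b) + 2β·(c) + ℰ·q6`. -/
theorem W_mul_T2oK_eq :
    (prob p (PDEvent ends u a₂ c) + prob p (TEvent ends a₂ u c)) * T2oK p ends o a₂ c b u =
      ((prob p (PDEvent ends u a₂ c) * prob p (connEvent ends a₂ b) + prob p (avoidAll ends a₂ {c}) * gap p ends u a₂ b) + (prob p Set.univ * EQb3 p ends u a₂ c b + prob p Set.univ * PDb p ends u a₂ c b + prob p (connEvent ends a₂ b) * EQ3 p ends u a₂ c + prob p (connEvent ends a₂ b) * prob p (avoidAll ends a₂ {u}) - (prob p Set.univ - prob p (avoidAll ends a₂ {c})) * gap p ends u a₂ b)) * (prob p (TEvent ends a₂ u c) * prob p (PDEvent ends u a₂ c ∩ connEvent ends a₂ o) - prob p (PDEvent ends u a₂ c) * prob p (TEvent ends a₂ u c ∩ connEvent ends a₂ o)) + 2 * (prob p Set.univ * prob p (PDEvent ends u a₂ c) + prob p (avoidAll ends a₂ {c}) * prob p (avoidAll ends a₂ {u})) * ((prob p (PDEvent ends u a₂ c) + prob p (TEvent ends a₂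 u c)) * prob p (TEvent ends a₂ u c ∩ (connEvent ends a₂ o ∩ connEvent ends a₂ b)) - (prob p (PDEvent ends u a₂ c ∩ connEvent ends a₂ o) + prob p (TEvent ends a₂ u c ∩ connEvent ends a₂ o)) * prob p (TEvent ends a₂ u c ∩ connEvent ends a₂ b)) + 2 * (prob p Set.univ * prob p (PDEvent ends u a₂ c) + prob p (avoidAll ends a₂ {c}) * prob p (avoidAll ends a₂ {u})) * ((prob p (PDEvent ends u a₂ c ∩ connEvent ends a₂ o) + prob p (TEvent ends a₂ u c ∩ connEvent ends a₂ o)) * (prob p (PDEvent ends u a₂ c ∩ connEvent ends u b) + prob p (TEvent ends a₂ u c ∩ connEvent ends u b)) - (prob p (PDEvent ends u a₂ c) + prob p (TEvent ends a₂ u c)) * (prob p (PDEvent ends u a₂ c ∩ (connEvent ends a₂ o ∩ connEvent ends u b)) + prob p (TEvent ends a₂ u c ∩ (connEvent ends a₂ o ∩ connEvent ends u b)))) + Ee p ends a₂ c b u * (prob p (avoidAll ends a₂ {c} ∩ connEvent ends a₂ o) * (prob p (PDEvent ends u a₂ c) + prob p (TEvent ends a₂ u c)) - prob p (avoidAll ends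 a₂ {c}) * (prob p (PDEvent ends u a₂ c ∩ connEvent ends a₂ o) + prob p (TEvent ends a₂ u c ∩ connEvent ends a₂ o))) := by
  have hZ := Qsplit_univ p ends u a₂ c
  have hbK := Qsplit p ends u a₂ c (connEvent ends a₂ b)
  have hbL := Qsplit p ends u a₂ c (connEvent ends u b)
  have hgap := gap_eq_Q p ends u a₂ b
  unfold T2oK Ee EQb3 PDb EQ3
  rw [hgap, hZ, hbK, hbL, prob_univ]
  ring

omit [Fintype E] [DecidableEq E] [Fintype V] [DecidableEq V] [LinearOrder R] [IsStrictOrderedRing R] in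
/-- `{a₂ ↮ c} = (connEvent a₂ c)ᶜ`. -/
lemma avoid_singleton_eq : avoidAll ends a₂ {c} = (connEvent ends a₂ c)ᶜ := by
  ext ω
  simp only [mem_avoidAll, Finset.mem_singleton, forall_eq, Set.mem_compl_iff, mem_connEvent]

omit [Fintype E] [DecidableEq E] [Fintype V] [LinearOrder R] [IsStrictOrderedRing R] in
/-- `{a₂ ↮ c} ∩ {a₂ ↮ u} = {a₂ ↮ {u, c}}`. -/
lemma avoid_c_inter_not_u_eq : avoidAll ends a₂ {c} ∩ (connEvent ends a₂ u)ᶜ = avoidAll ends a₂ {u, c} := by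
  ext ω
  simp only [Set.mem_inter_iff, mem_avoidAll, Finset.mem_singleton, forall_eq, Set.mem_compl_iff, mem_connEvent,
    Finset.mem_insert, forall_eq_or_imp]
  tauto

/-- **`0 ≤ q6`**: `d0·P(R′,oK) ≤ e0·W′` — BHK06 Thm 1.3 on `{a₂ ↮ c}`: `1_{o ∈ K}` and `1_{u ∈ K}` are
positively correlated given `K ∌ c`. -/
theorem q6_nonneg (hp : IsProbVec p) : 0 ≤ (prob p (avoidAll ends a₂ {c} ∩ connEvent ends a₂ o) * (prob p (PDEvent ends u a₂ c) + prob p (TEvent ends a₂ u c)) - prob p (avoidAll ends a₂ {c}) * (prob p (PDEvent ends u a₂ c ∩ connEvent ends a₂ o) + prob p (TEvent ends a₂ u c ∩ connEvent ends a₂ o))) := by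
  classical
  have key := bhk_same_cluster_events p hp ends a₂ c (isUpperSet_mem_setOf o) (isUpperSet_mem_setOf u)
  rw [← connEvent_eq_clusterInEvent ends a₂ o, ← connEvent_eq_clusterInEvent ends a₂ u] at key
  have hW : (prob p (PDEvent ends u a₂ c) + prob p (TEvent ends a₂ u c)) = prob p (avoidAll ends a₂ {c}) - prob p (avoidAll ends a₂ {c} ∩ connEvent ends a₂ u) := by
    rw [KMaster.prob_Rp p ends a₂ c u, ← avoid_c_inter_not_u_eq]
    have h := prob_inter_add_prob_inter_compl p (avoidAll ends a₂ {c}) (connEvent ends a₂ u)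
    linarith
  have hR : (prob p (PDEvent ends u a₂ c ∩ connEvent ends a₂ o) + prob p (TEvent ends a₂ u c ∩ connEvent ends a₂ o)) = prob p (avoidAll ends a₂ {c} ∩ connEvent ends a₂ o) -
      prob p (avoidAll ends a₂ {c} ∩ connEvent ends a₂ o ∩ connEvent ends a₂ u) := by
    rw [KMaster.prob_Rp_inter p ends a₂ c u (connEvent ends a₂ o), ← avoid_c_inter_not_u_eq]
    have h := prob_inter_add_prob_inter_compl p (avoidAll ends a₂ {c} ∩ connEvent ends a₂ o) (connEvent ends a₂ u)
    have e : avoidAll ends a₂ {c} ∩ (connEvent ends a₂ u)ᶜ ∩ connEvent ends a₂ o =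
        avoidAll ends a₂ {c} ∩ connEvent ends a₂ o ∩ (connEvent ends a₂ u)ᶜ := by
      ext ω; simp only [Set.mem_inter_iff]; tauto
    rw [e]
    linarith
  rw [hW, hR, avoid_singleton_eq]
  have e1 : (connEvent ends a₂ c)ᶜ ∩ connEvent ends a₂ u = connEvent ends a₂ u ∩ (connEvent ends a₂ c)ᶜ :=
    Set.inter_comm _ _
  have e2 : (connEvent ends a₂ c)ᶜ ∩ connEvent ends a₂ o = connEvent ends a₂ o ∩ (connEvent ends a₂ c)ᶜ :=
    Set.inter_comm _ _
  have e3 : connEvent ends a₂ o ∩ (connEvent ends a₂ c)ᶜ ∩ connEvent ends a₂ u =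
      connEvent ends a₂ o ∩ connEvent ends a₂ u ∩ (connEvent ends a₂ c)ᶜ := by
    ext ω; simp only [Set.mem_inter_iff]; tauto
  rw [e1, e2, e3]
  nlinarith [key]

/-- **`0 ≤ (c)`**: `W′·P(R′,oK,bL) ≤ P(R′,oK)·P(R′,bL)` — BHK06 Thm 1.4 on `R′` (`{o ∈ K}` against `{b ∈ L}`). -/
theorem c_nonneg (hp : IsProbVec p) : 0 ≤ ((prob p (PDEvent ends u a₂ c ∩ connEvent ends a₂ o) + prob p (TEvent ends a₂ u c ∩ connEvent ends a₂ o)) * (prob p (PDEvent ends u a₂ c ∩ connEvent ends u b) + prob p (TEvent ends a₂ u c ∩ connEvent ends u b)) - (prob p (PDEvent ends u a₂ c) + prob p (TEvent ends a₂ u c)) * (prob p (PDEvent ends u a₂ c ∩ (connEvent ends a₂ o ∩ connEvent ends u b)) + prob p (TEvent ends a₂ u c ∩ (connEvent ends a₂ o ∩ connEvent ends u b)))) := by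
  classical
  have h := bhk_cross_cluster_avoid p hp ends a₂ u (X := {u, c}) (Finset.mem_insert_self u {c})
    (isUpperSet_mem_setOf o) (isUpperSet_mem_setOf b)
  rw [← connEvent_eq_clusterInEvent ends a₂ o, ← connEvent_eq_clusterInEvent ends u b, KMaster.oK_bL_avoid_eq,
    Set.inter_comm (connEvent ends a₂ o) (avoidAll ends a₂ {u, c}),
    Set.inter_comm (connEvent ends u b) (avoidAll ends a₂ {u, c}),
    ← KMaster.prob_Rp_inter p ends a₂ c u (connEvent ends a₂ o ∩ connEvent ends u b),
    ← KMaster.prob_Rp_inter p ends a₂ c u (connEvent ends a₂ o),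
    ← KMaster.prob_Rp_inter p ends a₂ c u (connEvent ends u b),
    ← KMaster.prob_Rp p ends a₂ c u] at h
  linarith [h]

/-- **`0 ≤ T2oK` on every instance with `0 ≤ K3 := A·δK + 2β·(b)`** — the reduction of the `o ∈ K` half to the
single whole-instance claim `0 ≤ K3`: `W′·T2oK = K3 + 2β·(c) + ℰ·q6 ≥ 0`, so `T2oK ≥ 0` when `W′ > 0`; when
`W′ = 0` every `R′`-mass vanishes and `T2oK = ℰ·e0 ≥ 0`. -/
theorem T2oK_nonneg_of_K3 (hp : IsProbVec p) (hK3 : 0 ≤ (((prob p (PDEvent ends u a₂ c) * prob p (connEvent ends a₂ b) + prob p (avoidAll ends a₂ {c}) * gap p ends u a₂ b) + (prob p Set.univ * EQb3 p ends u a₂ c b + prob p Set.univ * PDb p ends u a₂ c b + prob p (connEvent ends a₂ b) * EQ3 p ends u a₂ c + prob p (connEvent ends a₂ b) * prob p (avoidAll ends a₂ {u}) - (prob p Set.univ - prob p (avoidAll ends a₂ {c})) * gap p ends u a₂ b)) * (prob p (TEvent ends a₂ u c) * prob p (PDEvent ends u a₂ c ∩ connEvent ends a₂ o) - prob p (PDEvent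 ends u a₂ c) * prob p (TEvent ends a₂ u c ∩ connEvent ends a₂ o)) + 2 * (prob p Set.univ * prob p (PDEvent ends u a₂ c) + prob p (avoidAll ends a₂ {c}) * prob p (avoidAll ends a₂ {u})) * ((prob p (PDEvent ends u a₂ c) + prob p (TEvent ends a₂ u c)) * prob p (TEvent ends a₂ u c ∩ (connEvent ends a₂ o ∩ connEvent ends a₂ b)) - (prob p (PDEvent ends u a₂ c ∩ connEvent ends a₂ o) + prob p (TEvent ends a₂ u c ∩ connEvent ends a₂ o)) * prob p (TEvent ends a₂ u c ∩ connEvent ends a₂ b)))) : 0 ≤ T2oK p ends o a₂ c b u := by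
  classical
  have key := W_mul_T2oK_eq p ends o a₂ c b u
  have hc := c_nonneg p ends o a₂ c b u hp
  have hq := q6_nonneg p ends o a₂ c u hp
  have hE := Ee_nonneg p ends a₂ c b u hp
  have n_D := prob_nonneg hp (PDEvent ends u a₂ c)
  have n_tp := prob_nonneg hp (TEvent ends a₂ u c)
  have n_d0 := prob_nonneg hp (avoidAll ends a₂ {c})
  have n_Z := prob_nonneg hp (avoidAll ends a₂ {u})
  have n_e0 := prob_nonneg hp (avoidAll ends a₂ {c} ∩ connEvent ends a₂ o)
  have n_β : 0 ≤ (prob p Set.univ * prob p (PDEvent ends u a₂ c) + prob p (avoidAll ends a₂ {c}) * prob p (avoidAll ends a₂ {u})) := by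
    rw [prob_univ]
    nlinarith [mul_nonneg n_d0 n_Z]
  rcases eq_or_lt_of_le (add_nonneg n_D n_tp) with hW0 | hWpos
  · -- `W′ = 0`: `D = t′ = 0`, every `PD`- and `T′`-mass vanishes, `T2oK = ℰ·e0`
    have hD : prob p (PDEvent ends u a₂ c) = 0 := by linarith
    have ht : prob p (TEvent ends a₂ u c) = 0 := by linarith
    have z : ∀ X : Set (Config E), prob p (PDEvent ends u a₂ c ∩ X) = 0 :=
      fun X => le_antisymm (hD ▸ prob_mono hp Set.inter_subset_left) (prob_nonneg hp _)
    have z' : ∀ X : Set (Config E), prob p (TEvent ends a₂ u c ∩ X) = 0 :=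
      fun X => le_antisymm (ht ▸ prob_mono hp Set.inter_subset_left) (prob_nonneg hp _)
    unfold T2oK
    rw [z, z, z', z', z', hD]
    simp only [mul_zero, zero_mul, sub_zero, add_zero, zero_add]
    exact mul_nonneg hE n_e0
  · have hpos : 0 ≤ (prob p (PDEvent ends u a₂ c) + prob p (TEvent ends a₂ u c)) * T2oK p ends o a₂ c b u := by
      rw [key]
      have h1 : 0 ≤ 2 * (prob p Set.univ * prob p (PDEvent ends u a₂ c) + prob p (avoidAll ends a₂ {c}) * prob p (avoidAll ends a₂ {u})) * ((prob p (PDEvent ends u a₂ c ∩ connEvent ends a₂ o) + prob p (TEvent ends a₂ u c ∩ connEvent ends a₂ o)) * (prob p (PDEvent ends u a₂ c ∩ connEvent ends u b) + prob p (TEvent ends a₂ u c ∩ connEvent ends u b)) - (prob p (PDEvent ends u a₂ c) + prob p (TEvent ends a₂ u c)) * (prob p (PDEvent ends u a₂ c ∩ (connEvent ends a₂ o ∩ connEvent ends u b)) + prob p (TEvent ends a₂ u c ∩ (connEvent ends a₂ o ∩ connEvent ends u b)))) := mul_nonneg (mul_nonneg (by norm_num) n_β) hc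
      have h2 : 0 ≤ Ee p ends a₂ c b u * (prob p (avoidAll ends a₂ {c} ∩ connEvent ends a₂ o) * (prob p (PDEvent ends u a₂ c) + prob p (TEvent ends a₂ u c)) - prob p (avoidAll ends a₂ {c}) * (prob p (PDEvent ends u a₂ c ∩ connEvent ends a₂ o) + prob p (TEvent ends a₂ u c ∩ connEvent ends a₂ o))) := mul_nonneg hE hq
      linarith
    by_contra hneg
    have := mul_neg_of_pos_of_neg hWpos (not_le.mp hneg)
    linarith

/-- **`0 ≤ F1 := hb·δK + (b)`** with `hb = P(a₂ ↔ b)`: under `P(· | a₂ ↮ {u, c})`,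
`Cov(1_{o∈K}, P(c ∈ L | K)·(1_{b∈K} − hb)) ≥ 0` — p4 g14's `ρ = hb` mixed-covariance bound without its `b ∈ L` slack
(the same proof: `J0_eq`, `J_le`, the antitone `φ(L)` against `1_{o∈K}` by `bhk_cross_functional_avoid`). -/
theorem F1_nonneg (hp : IsProbVec p) : 0 ≤ (prob p (connEvent ends a₂ b) * (prob p (TEvent ends a₂ u c) * prob p (PDEvent ends u a₂ c ∩ connEvent ends a₂ o) - prob p (PDEvent ends u a₂ c) * prob p (TEvent ends a₂ u c ∩ connEvent ends a₂ o)) + ((prob p (PDEvent ends u a₂ c) + prob p (TEvent ends a₂ u c)) * prob p (TEvent ends a₂ u c ∩ (connEvent ends a₂ o ∩ connEvent ends a₂ b)) - (prob p (PDEvent ends u a₂ c ∩ connEvent ends a₂ o) + prob p (TEvent ends a₂ u c ∩ connEvent ends a₂ o)) * prob p (TEvent ends a₂ u c ∩ connEvent ends a₂ b))) := by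
  classical
  have hφanti := MixK.phi_antitone p ends a₂ c b hp
  have hφ0 := MixK.phi_nonneg p ends a₂ c b hp
  have hF₁ : Monotone (({W : Set V | o ∈ W}).indicator (1 : Set V → R)) :=
    monotone_indicator_one_of_isUpperSet (fun _ _ h ho => h ho)
  have hF₁0 : ∀ S, 0 ≤ ({W : Set V | o ∈ W}).indicator (1 : Set V → R) S :=
    fun S => Set.indicator_apply_nonneg fun _ => zero_le_one
  have hu : u ∈ ({u, c} : Finset V) := by simp
  have key := bhk_cross_functional_avoid p hp ends a₂ u hu hF₁ hF₁0 hφanti hφ0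
  have e1 : expect p (fun ω => ({W : Set V | o ∈ W}).indicator (1 : Set V → R) (cluster ends ω a₂) *
      (avoidAll ends a₂ {u, c}).indicator 1 ω) =
      prob p (PDEvent ends u a₂ c ∩ connEvent ends a₂ o) +
        prob p (TEvent ends a₂ u c ∩ connEvent ends a₂ o) := by
    rw [← prob_clusterInEvent_inter_eq_expect, ExploreA3.clusterInEvent_mem_eq, Set.inter_comm,
      MixK.prob_N_inter p ends a₂ c u (connEvent ends a₂ o)]
  have e2 : prob p (avoidAll ends a₂ {u, c}) =
      prob p (PDEvent ends u a₂ c) + prob p (TEvent ends a₂ u c) := by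
    have h := MixK.prob_N_inter p ends a₂ c u Set.univ
    simpa only [Set.inter_univ] using h
  have e3 : expect p (fun ω =>
      (({W : Set V | c ∈ W}).indicator (delClusterProb p ends a₂ {W : Set V | b ∈ W}) (cluster ends ω u) +
        ({W : Set V | c ∉ W}).indicator (fun _ => prob p (connEvent ends a₂ b)) (cluster ends ω u)) *
      (avoidAll ends a₂ {u, c}).indicator 1 ω) =
      prob p (TEvent ends a₂ u c ∩ connEvent ends a₂ b) +
        prob p (connEvent ends a₂ b) * prob p (PDEvent ends u a₂ c) := by
    have e : (fun ω =>
        (({W : Set V | c ∈ W}).indicator (delClusterProb p ends a₂ {W : Set V | b ∈ W}) (cluster ends ω u) +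
          ({W : Set V | c ∉ W}).indicator (fun _ => prob p (connEvent ends a₂ b)) (cluster ends ω u)) *
        (avoidAll ends a₂ {u, c}).indicator 1 ω) =
        fun ω => ({W : Set V | c ∈ W}).indicator (1 : Set V → R) (cluster ends ω u) *
          delClusterProb p ends a₂ {W : Set V | b ∈ W} (cluster ends ω u) *
          (avoidAll ends u {a₂}).indicator 1 ω +
        prob p (connEvent ends a₂ b) * (PDEvent ends u a₂ c).indicator 1 ω :=
      funext fun ω => MixK.phi_mul_R_eq p ends a₂ c b u ω
    rw [e, MixK.expect_add_fun p (fun ω => ({W : Set V | c ∈ W}).indicator (1 : Set V → R) (cluster ends ω u) *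
          delClusterProb p ends a₂ {W : Set V | b ∈ W} (cluster ends ω u) *
          (avoidAll ends u {a₂}).indicator 1 ω)
        (fun ω => prob p (connEvent ends a₂ b) * (PDEvent ends u a₂ c).indicator 1 ω),
      expect_const_mul, ← prob_eq_expect_indicator, MixK.J0_eq]
  have e4 : expect p (fun ω => ({W : Set V | o ∈ W}).indicator (1 : Set V → R) (cluster ends ω a₂) *
      (({W : Set V | c ∈ W}).indicator (delClusterProb p ends a₂ {W : Set V | b ∈ W}) (cluster ends ω u) +
        ({W : Set V | c ∉ W}).indicator (fun _ => prob p (connEvent ends a₂ b)) (cluster ends ω u)) *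
      (avoidAll ends a₂ {u, c}).indicator 1 ω) =
      expect p (fun ω => ({W : Set V | c ∈ W}).indicator (1 : Set V → R) (cluster ends ω u) *
        delClusterProb p ends a₂ {W : Set V | b ∈ W} (cluster ends ω u) *
        (connEvent ends a₂ o).indicator 1 ω * (avoidAll ends u {a₂}).indicator 1 ω) +
        prob p (connEvent ends a₂ b) * prob p (PDEvent ends u a₂ c ∩ connEvent ends a₂ o) := by
    have e : (fun ω => ({W : Set V | o ∈ W}).indicator (1 : Set V → R) (cluster ends ω a₂) *
        (({W : Set V | c ∈ W}).indicator (delClusterProb p ends a₂ {W : Set V | b ∈ W}) (cluster ends ω u) +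
          ({W : Set V | c ∉ W}).indicator (fun _ => prob p (connEvent ends a₂ b)) (cluster ends ω u)) *
        (avoidAll ends a₂ {u, c}).indicator 1 ω) =
        fun ω => ({W : Set V | c ∈ W}).indicator (1 : Set V → R) (cluster ends ω u) *
          delClusterProb p ends a₂ {W : Set V | b ∈ W} (cluster ends ω u) *
          (connEvent ends a₂ o).indicator 1 ω * (avoidAll ends u {a₂}).indicator 1 ω +
        prob p (connEvent ends a₂ b) * (PDEvent ends u a₂ c ∩ connEvent ends a₂ o).indicator 1 ω :=
      funext fun ω => MixK.oK_phi_mul_R_eq p ends o a₂ c b u ω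
    rw [e, MixK.expect_add_fun p (fun ω => ({W : Set V | c ∈ W}).indicator (1 : Set V → R) (cluster ends ω u) *
          delClusterProb p ends a₂ {W : Set V | b ∈ W} (cluster ends ω u) *
          (connEvent ends a₂ o).indicator 1 ω * (avoidAll ends u {a₂}).indicator 1 ω)
        (fun ω => prob p (connEvent ends a₂ b) * (PDEvent ends u a₂ c ∩ connEvent ends a₂ o).indicator 1 ω),
      expect_const_mul, ← prob_eq_expect_indicator]
  rw [e1, e2, e3, e4] at key
  have hJ := MixK.J_le p ends o a₂ c b u hp
  have hP0 : 0 ≤ prob p (PDEvent ends u a₂ c) + prob p (TEvent ends a₂ u c) :=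
    add_nonneg (prob_nonneg hp _) (prob_nonneg hp _)
  have key2 := mul_le_mul_of_nonneg_right (add_le_add_right hJ
    (prob p (connEvent ends a₂ b) * prob p (PDEvent ends u a₂ c ∩ connEvent ends a₂ o))) hP0
  nlinarith [key, key2]

/-- **`0 ≤ T2oK` whenever `2β·hb ≤ A`** (the class of p4 g14's (K-hb), re-proved through `K3`): there
`K3 = (A − 2β·hb)·δK + 2β·F1 ≥ 0`. -/
theorem T2oK_nonneg_of_A_ge (hp : IsProbVec p) (hA : 2 * (prob p Set.univ * prob p (PDEvent ends u a₂ c) + prob p (avoidAll ends a₂ {c}) * prob p (avoidAll ends a₂ {u})) * prob p (connEvent ends a₂ b) ≤ ((prob p (PDEvent ends u a₂ c) * prob p (connEvent ends a₂ b) + prob p (avoidAll ends a₂ {c}) * gap p ends u a₂ b) + (prob p Set.univ * EQb3 p ends u a₂ c b + prob p Set.univ * PDb p ends u a₂ c b + prob p (connEvent ends a₂ b) * EQ3 p ends u a₂ c + prob p (connEvent ends a₂ b) * prob p (avoidAll ends a₂ {u}) - (prob p Set.univ - prob p (avoidAll ends a₂ {c})) * gap p ends u a₂ b))) : 0 ≤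 T2oK p ends o a₂ c b u := by
  classical
  refine T2oK_nonneg_of_K3 p ends o a₂ c b u hp ?_
  have hF := F1_nonneg p ends o a₂ c b u hp
  have hδ := KMaster.deltaK_nonneg p ends o a₂ c u hp
  have n_d0 := prob_nonneg hp (avoidAll ends a₂ {c})
  have n_Z := prob_nonneg hp (avoidAll ends a₂ {u})
  have n_D := prob_nonneg hp (PDEvent ends u a₂ c)
  have n_β : 0 ≤ (prob p Set.univ * prob p (PDEvent ends u a₂ c) + prob p (avoidAll ends a₂ {c}) * prob p (avoidAll ends a₂ {u})) := by
    rw [prob_univ]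
    nlinarith [mul_nonneg n_d0 n_Z]
  nlinarith [mul_nonneg (sub_nonneg.2 hA) hδ, mul_nonneg n_β hF]

/-- **`0 ≤ K3` from `0 ≤ K4 := P(R,bK)·δK + P(R)·(b)`** (`R = {u ↮ a₂, u ↮ c}`, `P(R) = D + t`, `P(R,bK) = P(PD,bK) + P(T,bK)`):
claim (i) (`LMaster.claim_i`) gives `P(R)·A ≥ 2β·P(R,bK)`, so `P(R)·K3 = (P(R)·A − 2β·P(R,bK))·δK + 2β·K4 ≥ 0`; when
`P(R) = 0` every `PD`- and `T`-mass vanishes, `δK = 0`, `Q = T′` up to null sets and `K3 = 2β·B1K ≥ 0` by BHK06 Thm 1.3 on `Q`.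
So the `o ∈ K` half is reduced to `0 ≤ K4`, i.e. `Cov(1_{o∈K}, P(c ∈ L | K)·(1_{b∈K} − P(bK | R))) ≥ 0` under
`P(· | a₂ ↮ {u, c})` — the `ρ = P(a₂ ↔ b | u ↮ {a₂, c})` form of the mixed-covariance bound (census-true on 1,800 random
instances and exactly on the 2,208 harvest cells, with equality on the 1,124 `{u, a₂}`-pocket cells; its `PD`-form
`ρ = P(bK | PD)` is FALSE by an exact six-vertex counterexample, its `hb`-form is `F1_nonneg`). -/
theorem K3_nonneg_of_K4 (hp : IsProbVec p) (hK4 : 0 ≤ ((prob p (PDEvent ends u a₂ c ∩ connEvent ends a₂ b) + prob p (TEvent ends u a₂ c ∩ connEvent ends a₂ b)) * (prob p (TEvent ends a₂ u c) * prob p (PDEvent ends u a₂ c ∩ connEvent ends a₂ o) - prob p (PDEvent ends u a₂ c) * prob p (TEvent ends a₂ u c ∩ connEvent ends a₂ o)) + (prob p (PDEvent ends u a₂ c) + prob p (TEvent ends u a₂ c)) * ((prob p (PDEvent ends u a₂ c) + prob p (TEvent ends a₂ u c)) * prob p (TEvent ends a₂ u c ∩ (connEvent ends a₂ o ∩ connEvent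 ends a₂ b)) - (prob p (PDEvent ends u a₂ c ∩ connEvent ends a₂ o) + prob p (TEvent ends a₂ u c ∩ connEvent ends a₂ o)) * prob p (TEvent ends a₂ u c ∩ connEvent ends a₂ b)))) : 0 ≤ (((prob p (PDEvent ends u a₂ c) * prob p (connEvent ends a₂ b) + prob p (avoidAll ends a₂ {c}) * gap p ends u a₂ b) + (prob p Set.univ * EQb3 p ends u a₂ c b + prob p Set.univ * PDb p ends u a₂ c b + prob p (connEvent ends a₂ b) * EQ3 p ends u a₂ c + prob p (connEvent ends a₂ b) * prob p (avoidAll ends a₂ {u}) - (prob p Set.univ - prob p (avoidAll ends a₂ {c})) * gap p ends u a₂ b)) * (prob p (TEvent ends a₂ u c) * prob p (PDEvent ends u a₂ c ∩ connEvent ends a₂ o) - prob p (PDEvent ends u a₂ c) * prob p (TEvent ends a₂ u c ∩ connEvent ends a₂ o)) + 2 * (prob p Set.univ * prob p (PDEvent ends u a₂ c) + prob p (avoidAll ends a₂ {c}) * prob p (avoidAll ends a₂ {u})) * ((prob p (PDEvent ends u a₂ c) + prob p (TEvent ends a₂ u c)) * prob p (TEvent ends a₂ u c ∩ (connEvent ends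 a₂ o ∩ connEvent ends a₂ b)) - (prob p (PDEvent ends u a₂ c ∩ connEvent ends a₂ o) + prob p (TEvent ends a₂ u c ∩ connEvent ends a₂ o)) * prob p (TEvent ends a₂ u c ∩ connEvent ends a₂ b))) := by
  classical
  have hi := LMaster.claim_i p ends a₂ c b u hp
  have hδ := KMaster.deltaK_nonneg p ends o a₂ c u hp
  have n_D := prob_nonneg hp (PDEvent ends u a₂ c)
  have n_t := prob_nonneg hp (TEvent ends u a₂ c)
  have n_d0 := prob_nonneg hp (avoidAll ends a₂ {c})
  have n_Z := prob_nonneg hp (avoidAll ends a₂ {u})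
  have n_β : 0 ≤ (prob p Set.univ * prob p (PDEvent ends u a₂ c) + prob p (avoidAll ends a₂ {c}) * prob p (avoidAll ends a₂ {u})) := by
    rw [prob_univ]
    nlinarith [mul_nonneg n_d0 n_Z]
  rcases eq_or_lt_of_le (add_nonneg n_D n_t) with hW0 | hWpos
  · -- `P(R) = 0`: the `PD`- and `T`-masses vanish and `K3 = 2β·B1K`
    have hD : prob p (PDEvent ends u a₂ c) = 0 := by linarith
    have ht : prob p (TEvent ends u a₂ c) = 0 := by linarith
    have zPD : ∀ X : Set (Config E), prob p (PDEvent ends u a₂ c ∩ X) = 0 :=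
      fun X => le_antisymm (hD ▸ prob_mono hp Set.inter_subset_left) (prob_nonneg hp _)
    have zT : ∀ X : Set (Config E), prob p (TEvent ends u a₂ c ∩ X) = 0 :=
      fun X => le_antisymm (ht ▸ prob_mono hp Set.inter_subset_left) (prob_nonneg hp _)
    -- BHK06 Thm 1.3 on `Q = {a₂ ↮ u}`: `P(Q,oK)·P(Q,bK) ≤ P(Q,oK,bK)·P(Q)`, and `Q = T′` up to null sets
    have key := bhk_same_cluster_events p hp ends a₂ u (isUpperSet_mem_setOf o) (isUpperSet_mem_setOf b)
    rw [← connEvent_eq_clusterInEvent ends a₂ o, ← connEvent_eq_clusterInEvent ends a₂ b,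
      ← avoid_singleton_eq ends a₂ u, Set.inter_comm (connEvent ends a₂ o) (avoidAll ends a₂ {u}),
      Set.inter_comm (connEvent ends a₂ b) (avoidAll ends a₂ {u}),
      Set.inter_comm (connEvent ends a₂ o ∩ connEvent ends a₂ b) (avoidAll ends a₂ {u})] at key
    have eQ : ∀ X : Set (Config E), prob p (avoidAll ends a₂ {u} ∩ X) = prob p (TEvent ends a₂ u c ∩ X) := by
      intro X
      rw [Qsplit p ends u a₂ c X, zPD, zT]
      ring
    have eQu : prob p (avoidAll ends a₂ {u}) = prob p (TEvent ends a₂ u c) := by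
      rw [Qsplit_univ p ends u a₂ c, hD, ht]
      ring
    rw [eQ, eQ, eQ, eQu] at key
    have z1 := zPD (connEvent ends a₂ o)
    rw [hD, z1]
    simp only [mul_zero, zero_mul, sub_zero, zero_add]
    nlinarith [mul_nonneg (mul_nonneg n_d0 n_Z) (sub_nonneg.2 key)]
  · -- `P(R) > 0`: `P(R)·K3 = (P(R)·A − 2β·P(R,bK))·δK + 2β·K4`
    have e : (prob p (PDEvent ends u a₂ c) + prob p (TEvent ends u a₂ c)) * (((prob p (PDEvent ends u a₂ c) * prob p (connEvent ends a₂ b) + prob p (avoidAll ends a₂ {c}) * gap p ends u a₂ b) + (prob p Set.univ * EQb3 p ends u a₂ c b + prob p Set.univ * PDb p ends u a₂ c b + prob p (connEvent ends a₂ b) * EQ3 p ends u a₂ c + prob p (connEvent ends a₂ b) * prob p (avoidAll ends a₂ {u}) - (prob p Set.univ - prob p (avoidAll ends a₂ {c})) * gap p ends u a₂ b)) * (prob p (TEvent ends a₂ u c) * prob p (PDEvent ends u a₂ c ∩ connEvent ends a₂ o) - prob p (PDEvent ends u a₂ c) * prob p (TEvent ends a₂ u c ∩ connEvent ends a₂ o))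 + 2 * (prob p Set.univ * prob p (PDEvent ends u a₂ c) + prob p (avoidAll ends a₂ {c}) * prob p (avoidAll ends a₂ {u})) * ((prob p (PDEvent ends u a₂ c) + prob p (TEvent ends a₂ u c)) * prob p (TEvent ends a₂ u c ∩ (connEvent ends a₂ o ∩ connEvent ends a₂ b)) - (prob p (PDEvent ends u a₂ c ∩ connEvent ends a₂ o) + prob p (TEvent ends a₂ u c ∩ connEvent ends a₂ o)) * prob p (TEvent ends a₂ u c ∩ connEvent ends a₂ b))) = ((prob p (PDEvent ends u a₂ c) + prob p (TEvent ends u a₂ c)) * ((prob p (PDEvent ends u a₂ c) * prob p (connEvent ends a₂ b) + prob p (avoidAll ends a₂ {c}) * gap p ends u a₂ b) + (prob p Set.univ * EQb3 p ends u a₂ c b + prob p Set.univ * PDb p ends u a₂ c b + prob p (connEvent ends a₂ b) * EQ3 p ends u a₂ c + prob p (connEvent ends a₂ b) * prob p (avoidAll ends a₂ {u}) - (prob p Set.univ - prob p (avoidAll ends a₂ {c})) * gap p ends u a₂ b)) - 2 * (prob p Set.univ * prob p (PDEvent ends u a₂ c) + prob p (avoidAll ends a₂ {c}) * prob p (avoidAll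 ends a₂ {u})) * (prob p (PDEvent ends u a₂ c ∩ connEvent ends a₂ b) + prob p (TEvent ends u a₂ c ∩ connEvent ends a₂ b))) * (prob p (TEvent ends a₂ u c) * prob p (PDEvent ends u a₂ c ∩ connEvent ends a₂ o) - prob p (PDEvent ends u a₂ c) * prob p (TEvent ends a₂ u c ∩ connEvent ends a₂ o)) + 2 * (prob p Set.univ * prob p (PDEvent ends u a₂ c) + prob p (avoidAll ends a₂ {c}) * prob p (avoidAll ends a₂ {u})) * ((prob p (PDEvent ends u a₂ c ∩ connEvent ends a₂ b) + prob p (TEvent ends u a₂ c ∩ connEvent ends a₂ b)) * (prob p (TEvent ends a₂ u c) * prob p (PDEvent ends u a₂ c ∩ connEvent ends a₂ o) - prob p (PDEvent ends u a₂ c) * prob p (TEvent ends a₂ u c ∩ connEvent ends a₂ o)) + (prob p (PDEvent ends u a₂ c) + prob p (TEvent ends u a₂ c)) * ((prob p (PDEvent ends u a₂ c) + prob p (TEvent ends a₂ u c)) * prob p (TEvent ends a₂ u c ∩ (connEvent ends a₂ o ∩ connEvent ends a₂ b)) - (prob p (PDEvent ends u a₂ c ∩ connEvent ends a₂ o) +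 prob p (TEvent ends a₂ u c ∩ connEvent ends a₂ o)) * prob p (TEvent ends a₂ u c ∩ connEvent ends a₂ b))) := by ring
    have h0 : 0 ≤ (prob p (PDEvent ends u a₂ c) + prob p (TEvent ends u a₂ c)) * (((prob p (PDEvent ends u a₂ c) * prob p (connEvent ends a₂ b) + prob p (avoidAll ends a₂ {c}) * gap p ends u a₂ b) + (prob p Set.univ * EQb3 p ends u a₂ c b + prob p Set.univ * PDb p ends u a₂ c b + prob p (connEvent ends a₂ b) * EQ3 p ends u a₂ c + prob p (connEvent ends a₂ b) * prob p (avoidAll ends a₂ {u}) - (prob p Set.univ - prob p (avoidAll ends a₂ {c})) * gap p ends u a₂ b)) * (prob p (TEvent ends a₂ u c) * prob p (PDEvent ends u a₂ c ∩ connEvent ends a₂ o) - prob p (PDEvent ends u a₂ c) * prob p (TEvent ends a₂ u c ∩ connEvent ends a₂ o)) + 2 * (prob p Set.univ * prob p (PDEvent ends u a₂ c) + prob p (avoidAll ends a₂ {c}) * prob p (avoidAll ends a₂ {u})) * ((prob p (PDEvent ends u a₂ c) + prob p (TEvent ends a₂ u c)) * prob p (TEvent ends a₂ u c ∩ (connEvent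 ends a₂ o ∩ connEvent ends a₂ b)) - (prob p (PDEvent ends u a₂ c ∩ connEvent ends a₂ o) + prob p (TEvent ends a₂ u c ∩ connEvent ends a₂ o)) * prob p (TEvent ends a₂ u c ∩ connEvent ends a₂ b))) := by
      rw [e]
      exact add_nonneg (mul_nonneg hi hδ) (mul_nonneg (mul_nonneg (by norm_num) n_β) hK4)
    exact (mul_nonneg_iff_of_pos_left hWpos).mp h0

/-- **`0 ≤ T2oK` on every instance with `0 ≤ K4`** — the `o ∈ K` half of W1 reduced to the single whole-instance claim
`0 ≤ K4 = P(R,bK)·δK + P(R)·(b)`. -/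
theorem T2oK_nonneg_of_K4 (hp : IsProbVec p) (hK4 : 0 ≤ ((prob p (PDEvent ends u a₂ c ∩ connEvent ends a₂ b) + prob p (TEvent ends u a₂ c ∩ connEvent ends a₂ b)) * (prob p (TEvent ends a₂ u c) * prob p (PDEvent ends u a₂ c ∩ connEvent ends a₂ o) - prob p (PDEvent ends u a₂ c) * prob p (TEvent ends a₂ u c ∩ connEvent ends a₂ o)) + (prob p (PDEvent ends u a₂ c) + prob p (TEvent ends u a₂ c)) * ((prob p (PDEvent ends u a₂ c) + prob p (TEvent ends a₂ u c)) * prob p (TEvent ends a₂ u c ∩ (connEvent ends a₂ o ∩ connEvent ends a₂ b)) - (prob p (PDEvent ends u a₂ c ∩ connEvent ends a₂ o) + prob p (TEvent ends a₂ u c ∩ connEvent ends a₂ o)) * prob p (TEvent ends a₂ u c ∩ connEvent ends a₂ b)))) : 0 ≤ T2oK p ends o a₂ c b u :=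
  T2oK_nonneg_of_K3 p ends o a₂ c b u hp (K3_nonneg_of_K4 p ends o a₂ c b u hp hK4)

end KSide

end RootLeafU

end Summit.Ventures.PercRepro2
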